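import Summits.ResolutionOfSingularities.ResolutionOfSingularities.Theorems.FrobeniusLadderFInjectiveMacaulayficationSliceableCentre
import Summits.ResolutionOfSingularities.ResolutionOfSingularities.Theorems.FrobeniusLadderFInjectiveMacaulayficationPointFixableCentre
import HarnessLib

/-!
# Door v30, hole #4 (`stub_closedCentreExists`): the TAME/WILD split — `H4LocTame` (5e⁺), `WFixClosed`, and the sorry-free glue
# `closedCentreExists_of_tame_of_wfix : H4LocTame → WFixClosed → ClosedCentreExists` (crux `FInjectiveMacaulayfication`
# stmt-ResolutionOfSingularities-15315, chain w45a; res-L1-w45a-plan-1 R13.35 (1) / R14.1 (5) / ACK 17:20:30Z «stub-3 := (γ) WFix glue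
# landing»; text = res-L1-w45a-strat-1 `H4LocRepairSig.lean` §1′/§2′/§4′ (v1 82bbcfdd359a0e48 … v1.14 840c71cf3e2e4a74, bodies unchanged)
# VERBATIM against the tree's clause abbreviations `SliceableCentre.CMCl/FCl/FullCl/CentreData/ClosedCentreExists`; tri-2 junk + «≤ S»
# PASS a777a840b992580b; filer res-L1-w45a-stub-3)

[OURS · L1 W4.5a] Support file (`--supports stmt-ResolutionOfSingularities-15315 --as helper`); NOT a statement of any manuscript;
AI-written (AI review is weaker than expert review). Replaces the role of NOTHING in H. Hironaka's manuscript. The two `@[conjecture]`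
definitions are OURS research stubs (LINES under door v30's registered stub `stub_closedCentreExists`, never door stubs themselves).

* `TameAt X₁ b` — the TAME surrogate: the stalk at `b` is integrally closed (normal point);
* `PFixData p A` — an `𝔪_A`-primary non-zero centre all of whose affine blow-up charts are FULL at the primes over `𝔪_A`
  (the conclusion of the refuted 5e `stub_h4Loc` at `A = 𝒪_{X₁,b}`, verbatim);
* `H4LocTame` (5e⁺) — 5e with the hypothesis `TameAt X₁ b` added (the wild pinch, which refutes 5e, is not tame);
* `WFixClosed` — at a NON-tame bad closed point, the #4β datum `CentreData` directly;
* `closedCentreExists_of_tame_of_wfix` — **#4β ⇐ `H4LocTame` ∧ `WFixClosed`**: case on `TameAt X₁ b`; tame ⇒ the landed pointwise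
  producer `PointFixableCentre.pointFixable_h4` fed with the `PFixData` of `H4LocTame`; wild ⇒ `WFixClosed` is the datum. Its conclusion
  `SliceableCentre.ClosedCentreExists` is reducibly the text of door v30's `stub_closedCentreExists`.
Dimension-2 rungs of both stubs are in the tree modulo `Lipman1978SequenceFinite` (`WFixClosedAffineDim2(OfLipman)`, `RegularBlowupModelDim2`).
-/

-- single-problem summit: the doubled namespace component is forced
set_option linter.dupNamespace false

noncomputable section

open AlgebraicGeometry CategoryTheory Literature.AlgebraicGeometry.Resolution TopologicalSpace IsLocalRing

namespace Summit.ResolutionOfSingularities.ResolutionOfSingularities.Theorems.FInjectiveMacaulayfication.TameWildSplit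

open Summit.ResolutionOfSingularities.ResolutionOfSingularities.Theorems.FInjectiveMacaulayfication
open SliceableCentre

/-! ## §1 The TAME surrogate and the point-fix datum (Sig §1′/§2′, verbatim) -/

/-- **TAME surrogate (typed): normality of the stalk at `b`.** TRUE at every zoo specimen point, FALSE at the wild pinch; over-approximates
wildness (tame pinch points also fail it and are routed to `WFixClosed`, losslessly). [OURS] -/
def TameAt (X₁ : Scheme.{0}) (b : X₁) : Prop := IsIntegrallyClosed (X₁.presheaf.stalk b)

/-- PFix(A): an `𝔪_A`-primary nonzero centre `(c)` all of whose affine blow-up charts are FULL at the primes over `𝔪_A`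
(= the conclusion of 5e `stub_h4Loc` at `A = 𝒪_{X₁,b}`, verbatim). [folklore; OURS abbreviation] -/
abbrev PFixData (p : ℕ) (A : Type) [CommRing A] [IsLocalRing A] : Prop :=
  ∃ (n : ℕ) (c : Fin n → A), Ideal.span (Set.range c) ≠ ⊥ ∧ (Ideal.span (Set.range c)).radical = maximalIdeal A ∧
    ∀ (j : Fin n) (𝔔 : PrimeSpectrum (blowupAlgebra (Ideal.span (Set.range c)) (c j))),
      𝔔.asIdeal.comap (algebraMap A (blowupAlgebra (Ideal.span (Set.range c)) (c j))) = maximalIdeal A →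
      FullCl p (Localization.AtPrime 𝔔.asIdeal)

/-! ## §2 The two closed-point stubs (Sig §2′, verbatim) -/

/-- **5e⁺ = `H4LocTame`** [OURS · research stub]: 5e `stub_h4Loc` VERBATIM with ONE hypothesis added — `TameAt X₁ b` (the bad closed
point is a normal point). «≤ S?»: NOT ≤ S — research producer, quarantined under `stub_closedCentreExists`; true in dim 2. Why it might
fail: a normal isolated bad point whose every 𝔪-primary blow-up recreates a bad point over it with no decreasing invariant (the T-tower
phenomenon made permanent); no specimen known — every K-verdict so far found a point-fix. [candidate statement, OURS] -/
@[conjecture] def H4LocTame : Prop :=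
  ∀ (p : ℕ), p.Prime → ∀ (k : Type) [Field k] [CharP k p] (X₁ : Scheme.{0}) (f₁ : X₁ ⟶ Spec (.of k)),
    IsSeparated f₁ → LocallyOfFiniteType f₁ → QuasiCompact f₁ → IsIntegral X₁ →
    (∀ x : X₁, CMCl (X₁.presheaf.stalk x)) → Set.Finite {x : X₁ | ¬ FCl p (X₁.presheaf.stalk x)} →
    ∀ b : X₁, IsClosed ({b} : Set X₁) → ¬ FCl p (X₁.presheaf.stalk b) → TameAt X₁ b →
      PFixData p (X₁.presheaf.stalk b)

/-- **`WFixClosed`** [OURS · research stub]: at a NON-tame (non-normal) bad closed point `b` of an admissible pair, the #4β datum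
directly — a global nonzero centre `J ∋ b` (a centre THROUGH the non-normal curves is allowed: no radical condition) every blow-up along
which is FULL at every point over `supp J`. Specimen: wild pinch, `J` = conductor `(t,y)`, blow-up = normalisation `D̄ × 𝔸¹` (regular).
«≤ S?»: ≤ S_proj+(BP), not ≤ S literal — same grade as `stub_closedCentreExists`; a THEOREM modulo CP 2019 in dim `X₁ = 3`
(`ClosedCentreDimEq3`), modulo Lipman 1978 in dim 2 (`WFixClosedAffineDim2`). Why it might fail (dim ≥ 4): the normalisation over the
non-normal surface through `b` need not be CM and every CM-ification may re-create wild non-normal points — research content.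
[candidate statement, OURS] -/
@[conjecture] def WFixClosed : Prop :=
  ∀ (p : ℕ), p.Prime → ∀ (k : Type) [Field k] [CharP k p] (X₁ : Scheme.{0}) (f₁ : X₁ ⟶ Spec (.of k)),
    IsSeparated f₁ → LocallyOfFiniteType f₁ → QuasiCompact f₁ → IsIntegral X₁ →
    (∀ x : X₁, CMCl (X₁.presheaf.stalk x)) → Set.Finite {x : X₁ | ¬ FCl p (X₁.presheaf.stalk x)} →
    ∀ b : X₁, IsClosed ({b} : Set X₁) → ¬ FCl p (X₁.presheaf.stalk b) → ¬ TameAt X₁ b →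
      CentreData p X₁ b

/-! ## §3 The closed-stage producer kernel: #4β ⇐ `H4LocTame` ∧ `WFixClosed` (Sig §4′; no sorry) -/

/-- **#4β from the TAME/WILD split**: case on `TameAt X₁ b`; tame ⇒ the landed pointwise producer `PointFixableCentre.pointFixable_h4`
(p511156) fed with the PFix datum of `H4LocTame`; wild ⇒ `WFixClosed` is the datum. The conclusion `ClosedCentreExists` is reducibly the
text of door v30's `stub_closedCentreExists`. [folklore assembly; OURS] -/
theorem closedCentreExists_of_tame_of_wfix (hT : H4LocTame) (hW : WFixClosed) : ClosedCentreExists := by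
  intro p hp k _ _ X₁ f₁ hs hl hq hi hc hf b hbcl hb
  by_cases hn : IsIntegrallyClosed (X₁.presheaf.stalk b)
  · exact PointFixableCentre.pointFixable_h4 p hp k X₁ f₁ hs hl hq hi hc hf b hbcl hb
      (hT p hp k X₁ f₁ hs hl hq hi hc hf b hbcl hb hn)
  · exact hW p hp k X₁ f₁ hs hl hq hi hc hf b hbcl hb hn

/-- The same kernel with the conclusion EXPANDED to the door's `stub_closedCentreExists` / `h4β` binder text (no abbreviation),
for consumers that state the hole without `SliceableCentre`'s abbreviations. [folklore assembly; OURS] -/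
theorem closedCentreExists_of_tame_of_wfix_expanded (hT : H4LocTame) (hW : WFixClosed) :
    ∀ (p : ℕ), p.Prime → ∀ (k : Type) [Field k] [CharP k p] (X₁ : Scheme.{0}) (f₁ : X₁ ⟶ Spec (.of k)),
    IsSeparated f₁ → LocallyOfFiniteType f₁ → QuasiCompact f₁ → IsIntegral X₁ →
    (∀ x : X₁, ∀ d : ℕ, ringKrullDim (X₁.presheaf.stalk x) = d → ∀ s : Fin d → X₁.presheaf.stalk x,
      (Ideal.span (Set.range s)).radical.IsMaximal → RingTheory.Sequence.IsWeaklyRegular (X₁.presheaf.stalk x) (List.ofFn s)) →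
    Set.Finite {x : X₁ | ¬ ∀ d : ℕ, ringKrullDim (X₁.presheaf.stalk x) = d → ∀ s : Fin d → X₁.presheaf.stalk x,
      (Ideal.span (Set.range s)).radical.IsMaximal → ∀ y : X₁.presheaf.stalk x,
        (∃ e : ℕ, y ^ p ^ e ∈ Ideal.span ((fun z : X₁.presheaf.stalk x => z ^ p ^ e) '' (Ideal.span (Set.range s) : Set (X₁.presheaf.stalk x)))) →
        y ∈ Ideal.span (Set.range s)} →
    ∀ b : X₁, IsClosed ({b} : Set X₁) →
    (¬ ∀ d : ℕ, ringKrullDim (X₁.presheaf.stalk b) = d → ∀ s : Fin d → X₁.presheaf.stalk b,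
      (Ideal.span (Set.range s)).radical.IsMaximal → ∀ y : X₁.presheaf.stalk b,
        (∃ e : ℕ, y ^ p ^ e ∈ Ideal.span ((fun z : X₁.presheaf.stalk b => z ^ p ^ e) '' (Ideal.span (Set.range s) : Set (X₁.presheaf.stalk b)))) →
        y ∈ Ideal.span (Set.range s)) →
      ∃ J : X₁.IdealSheafData, J ≠ ⊥ ∧ b ∈ (J.support : Set X₁) ∧
        ∀ (X' : Scheme.{0}) (π : X' ⟶ X₁), IsBlowup π J →
          ∀ x' : X', π.base x' ∈ (J.support : Set X₁) → IsDomain (X'.presheaf.stalk x') ∧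
            ∀ d : ℕ, ringKrullDim (X'.presheaf.stalk x') = d → ∀ s : Fin d → X'.presheaf.stalk x',
              (Ideal.span (Set.range s)).radical.IsMaximal →
              RingTheory.Sequence.IsWeaklyRegular (X'.presheaf.stalk x') (List.ofFn s) ∧
              ∀ y : X'.presheaf.stalk x',
                (∃ e : ℕ, y ^ p ^ e ∈ Ideal.span ((fun z : X'.presheaf.stalk x' => z ^ p ^ e) '' (Ideal.span (Set.range s) : Set (X'.presheaf.stalk x')))) →
                y ∈ Ideal.span (Set.range s) :=
  closedCentreExists_of_tame_of_wfix hT hW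

end Summit.ResolutionOfSingularities.ResolutionOfSingularities.Theorems.FInjectiveMacaulayfication.TameWildSplit

end
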